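import Mathlib
import HarnessLib
import Summits.HubbardSuperconductivity.HubbardSuperconductivity.Theorems.KLProgrammeKLRegimeEngineGeneralStepPrivStepC2L2
import Summits.HubbardSuperconductivity.HubbardSuperconductivity.Theorems.KLProgrammeKLRegimeCountertermJacksonRemainderCertAnFitKlEng
import Summits.HubbardSuperconductivity.HubbardSuperconductivity.Theorems.KLProgrammeKLRegimeCountertermJacksonRemainderReadResidueC1TabFitA
import Summits.HubbardSuperconductivity.HubbardSuperconductivity.Theorems.KLProgrammeKLRegimeSplitGenericV3

/-!
# K3 gen-8-FLOW (stmt 20437, stub (C)): «(P)-STEP-ALL-DOORS», L2 — the private induction step with (B), (C2), (C1) by name, the (C2) rows on the U-AWARE table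
# (cell gate-hubbard-kl, seat p2 g23)

L2 twins of `twoLegReadPriv_flow_succ_deep` / `_table` (…GeneralStepPrivStepAllDoors): identical binders (stub (C)'s), the primed (C2) table `eT′` now only above the
L2 table of `transport_jets_flow_fit_of_spaceMoments_l2` (located «(C2)-L-DEGREE» cured: degree ≤ 2 in `R.Gfr`); the extra row `2(Gfr₃+Gfr₄)U² ≤ 1` is DISCHARGED
here from `U ≤ klEngU₀9 ≤ klEngU₀4` and k3c3-p1's `gfr_mul_le_of_le_klEngU₀4` (`Gfr_j·U ≤ 2⁻¹²⁷`).
* **`twoLegReadPriv_flow_succ_deep_l2`** (`5 ≤ m`), **`twoLegReadPriv_flow_succ_table_l2`** (`m + 1 ≤ 21`).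
Compositions only; no definitions; nothing asserts any stub of 20437, K3, the margin or superconductivity.  References: BGM 2006 §2.4 Lemma 2.1 (2.36)–(2.42)
[cite: BenfattoGiulianiMastropietro2006]; FST 1996 §1 [cite: FeldmanSalmhoferTrubowitz1996].
-/

noncomputable section

namespace Summit.HubbardSuperconductivity.HubbardSuperconductivity.Theorems.EngineV8

set_option linter.dupNamespace false -- summit = problem name (single-conjunct summit), D-0017
set_option exponentiation.threshold 1024 -- `2^200`/`2^282` literals in the budget expressions

open Complex Real Finset Filter Literature.MathematicalPhysics.QuantumLattice Literature.Probability.LatticeModels GrassmannAlgebra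
open Literature.MathematicalPhysics.QuantumLattice.BandSectorCounting Literature.MathematicalPhysics.QuantumLattice.FermiRG
open Literature.Analysis.Fourier Literature.Analysis.Calculus
open Summit.HubbardSuperconductivity.HubbardSuperconductivity.Theorems.KLRegimeSplit
open Summit.HubbardSuperconductivity.HubbardSuperconductivity.Theorems.DispersionFlow
open Summit.HubbardSuperconductivity.HubbardSuperconductivity.Theorems.KLProgrammeLegKernels
open Summit.HubbardSuperconductivity.HubbardSuperconductivity.Theorems.PerturbedFermiCurve
open scoped Nat

variable {L M : ℕ} [NeZero L] [NeZero M]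

/-- **«(P)-STEP-DEEP» — the private (P)-step at a DEEP general scale `5 ≤ m`, `m + 1 ≤ n_β`, with (B), (C2) AND (C1) discharged by name, (C2) on the U-AWARE (L2) table** (`2(Gfr₃+Gfr₄)U² ≤ 1` discharged from `Gfr_j·U ≤ 2⁻¹²⁷`)
((C1) = k3c3-p3's analytic branch `readResidueC1_hJ_analytic_klEng`, matrix `klC1AnFit`; the KL-regime clause at the reading scale is discharged by
`isKLRegime_of_le_nScales_succ`).  See the module docstring. [cite: BenfattoGiulianiMastropietro2006, §2.4 Lemma 2.1 (2.36)–(2.42)] -/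
theorem twoLegReadPriv_flow_succ_deep_l2 {P : SplitConsts} {R : RenConsts} (hRW : R.WF) {c : ℝ} (hc : 0 < c) (hc6 : c ≤ klEngC₃6 P R)
    {U : ℝ} (hU : 0 < U) (hU9 : U ≤ klEngU₀9 P R c) {β : ℝ} (hβmin : klBetaMin ≤ β) (hβc : β ≤ Real.exp (c / U ^ 2))
    {μ : ℝ} (hμ : μ ∈ klWindowC) (m : ℕ) (hm5 : 5 ≤ m) (hm1 : m + 1 ≤ nScales β)
    {G : GeoConsts} {Q : EngConsts} (hGS : ∀ k, 0 ≤ G.S k) (hQS : ∀ k, 0 ≤ Q.S' k)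
    {Nf₁ N : ℕ} (hOK₁ : FrameOK R U Nf₁ μ (klFlowFrameU L M β U μ m)) (hN₁ : Nf₁ ≤ m) (hOK₂ : FrameOK R U N μ (klFlowFrameU L M β U μ (m + 1))) (hNn : N ≤ m)
    (hZ₂ : IsUnit (effPartitionFn ℂ (normalCovariance L M (uvSymbolCT L M β μ (klFlowFrameU L M β U μ (m + 1)) (klScale klE0 m))) (hubbardInteraction L M β U + counterQuadratic L M β (klFlowFrameU L M β U μ (m + 1)))))
    (hZ : ∀ t ∈ Set.Icc (0 : ℝ) 1, effPartitionFn ℂ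
      (normalCovariance L M (uvSymbolCT L M β μ (klFlowFrameU L M β U μ m) (klScale klE0 m)) + ((t : ℂ)) • (normalCovariance L M (fun ks => uvSymbolCT L M β μ (klFlowFrameU L M β U μ (m + 1)) (klScale klE0 m) ks / (1 + uvSymbolCT L M β μ (klFlowFrameU L M β U μ (m + 1)) (klScale klE0 m) ks * (((fsub (klFlowFrameU L M β U μ (m + 1)) (klFlowFrameU L M β U μ m)).eval (latticeMomentum L ks.1.2) / (β * (L : ℝ) ^ 2) : ℝ) : ℂ))) - normalCovariance L M (uvSymbolCT L M β μ (klFlowFrameU L M β U μ m) (klScale klE0 m)))) (hubbardInteraction L M β U + counterQuadratic L M β (klFlowFrameU L M β U μ m)) ≠ 0)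
    -- the flow history and the closed envelopes (verbatim from the door)
    {n : ℕ} (hP : ∀ m' ≤ n, FlowPieceJetsAt L M β U μ R m') (hTJ : ∀ m' ≤ n, TwoLegReadJetsF L M G Q β U μ m') (hmn : m ≤ n)
    (hR0 : 0 < R.Gfr 0) {W Ξ Θ : ℝ} (hW : W = curveExtC (8 * 576 * (342 : ℝ) ^ 4) G.S 1 + curveExtC (8 * 576 * (342 : ℝ) ^ 4) Q.S' 1 * |U|)
    (hΞ : Ξ = (2 ^ 10 * (1 + Real.pi ^ 8 * (W * U ^ 2) / 2 ^ 11) + ∑ j ∈ range 5, R.Gfr j))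
    (hΘ : Θ = (1 + ((∑ j ∈ range 5, R.Gfr j) + Real.pi ^ 8 * W / 2 ^ 11) * |U| / R.Gfr 0))
    (hdoor : R.Gfr 0 * |U| + ((∑ j ∈ range 5, R.Gfr j) + Real.pi ^ 8 * W / 2 ^ 11) * U ^ 2 ≤ 1 / 128) (hL : klEngL₄ P R β U ≤ L)
    {s : ℕ} (hs : 30 ≤ s)
    -- E1: β-free graded constant families (four-leg: PURE weight, `U²` law at orders ≥ 1)
    {cN cS cE : ℕ → ℝ} {cSs cEs : ℝ} (hcN : ∀ l, 0 ≤ cN l) (hcS : ∀ l, 0 ≤ cS l) (hcE : ∀ l, 0 ≤ cE l) (hcSs : 0 ≤ cSs) (hcEs : 0 ≤ cEs)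
    (hNp0 : ∀ t ∈ Set.Icc (0 : ℝ) 1, ∀ (σ : Fin 2) (A : HubbardFieldIdx L M) (x₀ : SpaceTimeIdx L M), imagTimeWeight β M ^ 3 *
      ∑ x ∈ (univ : Finset (Fin 4 → SpaceTimeIdx L M)).filter (fun x => x 0 = x₀),
        (((((x 1).2 - (x 0).2) 0).valMinAbs.natAbs : ℝ) + ((((x 1).2 - (x 0).2) 1).valMinAbs.natAbs : ℝ)) ^ 0 *
          ‖sectorisedKernel L M β (trivialMultiplier L M)
            (effAction ℂ (normalCovariance L M (uvSymbolCT L M β μ (klFlowFrameU L M β U μ m) (klScale klE0 m)) + ((t : ℂ)) • (normalCovariance L M (fun ks => uvSymbolCT L M β μ (klFlowFrameU L M β U μ (m + 1)) (klScale klE0 m) ks / (1 + uvSymbolCT L M β μ (klFlowFrameU L M β U μ (m + 1)) (klScale klE0 m) ks * (((fsub (klFlowFrameU L M β U μ (m + 1)) (klFlowFrameU L M β U μ m)).eval (latticeMomentum L ks.1.2) / (β * (L : ℝ) ^ 2) : ℝ) : ℂ))) - normalCovariance L M (uvSymbolCT L M β μ (klFlowFrameU L M β U μ m) (klScale klE0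 m)))) (hubbardInteraction L M β U + counterQuadratic L M β (klFlowFrameU L M β U μ m))) 4
            (![((0, σ), 0), ((0, σ), 1), ((0, A.1.2), 1 - A.2), ((0, A.1.2), A.2)] : Fin 4 → SectorLeg 1) x‖ ≤ cN 0 * U)
    (hNp : ∀ l, 1 ≤ l → l ≤ 4 → ∀ t ∈ Set.Icc (0 : ℝ) 1, ∀ (σ : Fin 2) (A : HubbardFieldIdx L M) (x₀ : SpaceTimeIdx L M), imagTimeWeight β M ^ 3 *
      ∑ x ∈ (univ : Finset (Fin 4 → SpaceTimeIdx L M)).filter (fun x => x 0 = x₀),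
        (((((x 1).2 - (x 0).2) 0).valMinAbs.natAbs : ℝ) + ((((x 1).2 - (x 0).2) 1).valMinAbs.natAbs : ℝ)) ^ l *
          ‖sectorisedKernel L M β (trivialMultiplier L M)
            (effAction ℂ (normalCovariance L M (uvSymbolCT L M β μ (klFlowFrameU L M β U μ m) (klScale klE0 m)) + ((t : ℂ)) • (normalCovariance L M (fun ks => uvSymbolCT L M β μ (klFlowFrameU L M β U μ (m + 1)) (klScale klE0 m) ks / (1 + uvSymbolCT L M β μ (klFlowFrameU L M β U μ (m + 1)) (klScale klE0 m) ks * (((fsub (klFlowFrameU L M β U μ (m + 1)) (klFlowFrameU L M β U μ m)).eval (latticeMomentum L ks.1.2) / (β * (L : ℝ) ^ 2) : ℝ) : ℂ))) - normalCovariance L M (uvSymbolCT L M β μ (klFlowFrameU L M β U μ m) (klScale klE0 m)))) (hubbardInteraction L M β U + counterQuadratic L M β (klFlowFrameU L M β U μ m))) 4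
            (![((0, σ), 0), ((0, σ), 1), ((0, A.1.2), 1 - A.2), ((0, A.1.2), A.2)] : Fin 4 → SectorLeg 1) x‖ ≤ cN l * U ^ 2 * ((4 : ℝ) ^ m) ^ l)
    (hSp : ∀ l ≤ 4, ∀ t ∈ Set.Icc (0 : ℝ) 1, ∀ (σ : Fin 2) (x₀ : SpaceTimeIdx L M),
      (imagTimeWeight β M * ∑ x ∈ (univ : Finset (Fin 2 → SpaceTimeIdx L M)).filter (fun x => x 0 = x₀),
        (1 + ((((x 1).2 - (x 0).2) 0).valMinAbs.natAbs : ℝ) + ((((x 1).2 - (x 0).2) 1).valMinAbs.natAbs : ℝ)) ^ l *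
          ‖sectorisedKernel L M β (trivialMultiplier L M)
            (effAction ℂ (normalCovariance L M (uvSymbolCT L M β μ (klFlowFrameU L M β U μ m) (klScale klE0 m)) + ((t : ℂ)) • (normalCovariance L M (fun ks => uvSymbolCT L M β μ (klFlowFrameU L M β U μ (m + 1)) (klScale klE0 m) ks / (1 + uvSymbolCT L M β μ (klFlowFrameU L M β U μ (m + 1)) (klScale klE0 m) ks * (((fsub (klFlowFrameU L M β U μ (m + 1)) (klFlowFrameU L M β U μ m)).eval (latticeMomentum L ks.1.2) / (β * (L : ℝ) ^ 2) : ℝ) : ℂ))) - normalCovariance L M (uvSymbolCT L M β μ (klFlowFrameU L M β U μ m) (klScale klE0 m)))) (hubbardInteraction L M β U + counterQuadratic L M β (klFlowFrameU L M β U μ m))) 2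
            (![((0, σ), 0), ((0, σ), 1)] : Fin 2 → SectorLeg 1) x‖ ≤ cS l * U * ((4 : ℝ) ^ m) ^ l))
    (hSps : ∀ t ∈ Set.Icc (0 : ℝ) 1, ∀ (σ : Fin 2) (x₀ : SpaceTimeIdx L M),
      (imagTimeWeight β M * ∑ x ∈ (univ : Finset (Fin 2 → SpaceTimeIdx L M)).filter (fun x => x 0 = x₀),
        (1 + ((((x 1).2 - (x 0).2) 0).valMinAbs.natAbs : ℝ) + ((((x 1).2 - (x 0).2) 1).valMinAbs.natAbs : ℝ)) ^ s *
          ‖sectorisedKernel L M β (trivialMultiplier L M)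
            (effAction ℂ (normalCovariance L M (uvSymbolCT L M β μ (klFlowFrameU L M β U μ m) (klScale klE0 m)) + ((t : ℂ)) • (normalCovariance L M (fun ks => uvSymbolCT L M β μ (klFlowFrameU L M β U μ (m + 1)) (klScale klE0 m) ks / (1 + uvSymbolCT L M β μ (klFlowFrameU L M β U μ (m + 1)) (klScale klE0 m) ks * (((fsub (klFlowFrameU L M β U μ (m + 1)) (klFlowFrameU L M β U μ m)).eval (latticeMomentum L ks.1.2) / (β * (L : ℝ) ^ 2) : ℝ) : ℂ))) - normalCovariance L M (uvSymbolCT L M β μ (klFlowFrameU L M β U μ m) (klScale klE0 m)))) (hubbardInteraction L M β U + counterQuadratic L M β (klFlowFrameU L M β U μ m))) 2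
            (![((0, σ), 0), ((0, σ), 1)] : Fin 2 → SectorLeg 1) x‖ ≤ cSs * U * ((4 : ℝ) ^ m) ^ s))
    (hSEp : ∀ l ≤ 4, ∀ (σ : Fin 2) (x₀ : SpaceTimeIdx L M),
      (imagTimeWeight β M * ∑ x ∈ (univ : Finset (Fin 2 → SpaceTimeIdx L M)).filter (fun x => x 0 = x₀),
        (1 + ((((x 1).2 - (x 0).2) 0).valMinAbs.natAbs : ℝ) + ((((x 1).2 - (x 0).2) 1).valMinAbs.natAbs : ℝ)) ^ l *
          ‖sectorisedKernel L M β (trivialMultiplier L M)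
            (effAction ℂ (normalCovariance L M (fun ks => uvSymbolCT L M β μ (klFlowFrameU L M β U μ (m + 1)) (klScale klE0 m) ks / (1 + uvSymbolCT L M β μ (klFlowFrameU L M β U μ (m + 1)) (klScale klE0 m) ks * (((fsub (klFlowFrameU L M β U μ (m + 1)) (klFlowFrameU L M β U μ m)).eval (latticeMomentum L ks.1.2) / (β * (L : ℝ) ^ 2) : ℝ) : ℂ)))) (hubbardInteraction L M β U + counterQuadratic L M β (klFlowFrameU L M β U μ m))) 2
            (![((0, σ), 0), ((0, σ), 1)] : Fin 2 → SectorLeg 1) x‖ ≤ cE l * U * ((4 : ℝ) ^ m) ^ l))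
    (hSEs : ∀ (σ : Fin 2) (x₀ : SpaceTimeIdx L M),
      (imagTimeWeight β M * ∑ x ∈ (univ : Finset (Fin 2 → SpaceTimeIdx L M)).filter (fun x => x 0 = x₀),
        (1 + ((((x 1).2 - (x 0).2) 0).valMinAbs.natAbs : ℝ) + ((((x 1).2 - (x 0).2) 1).valMinAbs.natAbs : ℝ)) ^ s *
          ‖sectorisedKernel L M β (trivialMultiplier L M)
            (effAction ℂ (normalCovariance L M (fun ks => uvSymbolCT L M β μ (klFlowFrameU L M β U μ (m + 1)) (klScale klE0 m) ks / (1 + uvSymbolCT L M β μ (klFlowFrameU L M β U μ (m + 1)) (klScale klE0 m) ks * (((fsub (klFlowFrameU L M β U μ (m + 1)) (klFlowFrameU L M β U μ m)).eval (latticeMomentum L ks.1.2) / (β * (L : ℝ) ^ 2) : ℝ) : ℂ)))) (hubbardInteraction L M β U + counterQuadratic L M β (klFlowFrameU L M β U μ m))) 2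
            (![((0, σ), 0), ((0, σ), 1)] : Fin 2 → SectorLeg 1) x‖ ≤ cEs * U * ((4 : ℝ) ^ m) ^ s))
    -- the (B) budget word as a primed table
    {X : ℕ → ℝ} (hX0 : ∀ l, 0 ≤ X l)
    (hXv : 2 ^ 32 / 4 ^ 0 * R.Gfr 0 * cN 0 + (klEngRsq R ^ 4 * (cS 0 ^ 2 + cE 0 + 1) + (cSs ^ 2 + cEs + 1)) / 2 ^ 200 ≤ X 0)
    (hX : ∀ l, 1 ≤ l → l ≤ 4 → 2 ^ 32 / 4 ^ l * R.Gfr 0 * cN l + (klEngRsq R ^ 4 * (cS l ^ 2 + cE l + 1) + (cSs ^ 2 + cEs + 1)) / 2 ^ 200 ≤ X l)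
    -- the (P)-step's other inputs (k3c3-p1 `twoLegReadPriv_flow_succ` at `n := m`)
    (hLdeg : 4 * klFlowDeg (m + 1) ≤ L)
    {cA cA' cc cc' : ℕ → ℝ} {τA a x₀ : ℝ} (hcc : ∀ k, 0 ≤ cc k) (hcc' : ∀ k, 0 ≤ cc' k)
    -- (A): slice-increment jets and structured value at the new frame
    (hA : TwoLegCurveJetBound L M cA cA' β U μ (klFlowFrameU L M β U μ (m + 1)) (m + 1))
    (hAval : ∀ θ : ℝ, |klTwoLegCurveProfile L M β U μ (klFlowFrameU L M β U μ (m + 1)) (m + 1) θ - τA| ≤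
      a * U ^ 2 * (4 : ℝ) ^ (-2 * ((m + 1 : ℕ) : ℤ)))
    -- (C2): the #17 export at `(K_m, m)`, five n-free rows, and a primed table above `transport_jets_flow_fit`'s
    {z : ℕ → ℝ} (hZsp : TwoLegDualSpaceMomentsUpToAt L M (klZspLaw z U m) β U μ m 5)
    {mT : ℕ → ℝ} (hmT : ∀ j, 0 ≤ mT j)
    (hmT1 : 4 / 3 * R.Gfr 1 + 2 * z 1 ≤ mT 1) (hmT2 : R.Gfr 2 + 2 * z 2 ≤ mT 2) (hmT3 : R.Gfr 3 / 3 + 2 * z 3 ≤ mT 3)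
    (hmT4 : R.Gfr 4 / 15 + 2 * z 4 ≤ mT 4) (hmT5 : 2 ^ 5 * (Real.pi ^ 8 / 4 * 2 ^ 4 * (2 : ℝ) ^ 32) * (curveExtC (klChi2CauchyTab2 4) G.S 1 + curveExtC (klChi2CauchyTab2 4) Q.S' 1 * |U|) / 63 + 2 * z 5 ≤ mT 5)
    {eT' : ℕ → ℝ} (heT : ∀ k ≤ 4,
        (fun k : ℕ =>
          if k = 0 then 16 * ((12.2 * R.Gfr 0 * mT 1))
          else if k = 1 then 4 * ((1420 * 2 * (R.Gfr 1 + R.Gfr 2 + R.Gfr 3 + R.Gfr 4) * 2 * mT 1) + (36400 * R.Gfr 0 * mT 1) + (2820 * R.Gfr 0 * mT 2))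
          else if k = 2 then ((12900000 * 2 ^ 2 * (R.Gfr 1 + R.Gfr 2 + R.Gfr 3 + R.Gfr 4) * 2 ^ 2 * mT 1) + (657000 * 2 * (R.Gfr 1 + R.Gfr 2 + R.Gfr 3 + R.Gfr 4) * 2 * mT 2) + (338000000 * 2 * R.Gfr 0 * 2 * mT 1) + (25400000 * R.Gfr 0 * mT 2) + (652000 * R.Gfr 0 * mT 3))
          else if k = 3 then ((199000000000 * 2 ^ 3 * (R.Gfr 1 + R.Gfr 2 + R.Gfr 3 + R.Gfr 4) * 2 ^ 3 * mT 1) + (12000000000 * 2 ^ 2 * (R.Gfr 1 + R.Gfr 2 + R.Gfr 3 + R.Gfr 4) * 2 ^ 2 * mT 2) + (228000000 * 2 * (R.Gfr 1 + R.Gfr 2 + R.Gfr 3 + R.Gfr 4) * 2 * mT 3) + (5230000000000 * 2 ^ 2 * R.Gfr 0 * 2 ^ 2 * mT 1) + (392000000000 * 2 * R.Gfr 0 * 2 * mT 2) + (11800000000 * R.Gfr 0 * mT 3) + (151000000 * R.Gfr 0 * mT 4)) / 4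
          else if k = 4 then ((4300000000000000 * 2 ^ 4 * (R.Gfr 1 + R.Gfr 2 + R.Gfr 3 + R.Gfr 4) * 2 ^ 4 * mT 1) + (276000000000000 * 2 ^ 3 * (R.Gfr 1 + R.Gfr 2 + R.Gfr 3 + R.Gfr 4) * 2 ^ 3 * mT 2) + (6890000000000 * 2 ^ 2 * (R.Gfr 1 + R.Gfr 2 + R.Gfr 3 + R.Gfr 4) * 2 ^ 2 * mT 3) + (70100000000 * 2 * (R.Gfr 1 + R.Gfr 2 + R.Gfr 3 + R.Gfr 4) * 2 * mT 4) + (114000000000000000 * 2 ^ 2 * R.Gfr 0 * 2 ^ 2 * mT 1) + (8490000000000000 * 2 ^ 2 * R.Gfr 0 * 2 ^ 2 * mT 2) + (272000000000000 * 2 * R.Gfr 0 * 2 * mT 3) + (4530000000000 * R.Gfr 0 * mT 4) + (34800000000 * R.Gfr 0 * mT 5) + (69200000000 * (16 / 15) * R.Gfr 4 * mT 1)) / 16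
          else 0) k ≤ eT' k)
    -- (C1): the window certificate of the analytic branch and the induction hypothesis (jets half) at the private tables
    (hcertA : KlwjCertA) (hIH : TwoLegReadJetBound L M cc cc' β U μ (klFlowFrameU L M β U μ m) m)
    -- the three private fits: (B), (C2) un-primed columns EMPTY, (C1) = the analytic matrix `klC1AnFit`
    (hfit : ∀ k, cA k + klC1AnFit cc k ≤ cc k)
    (hfit' : ∀ k, cA' k + ((if k = 0 then X 0 else readJetC X k + readJetC' R X k) + eT' k + klC1AnFit' cc cc' k) ≤ cc' k)
    (hfitO : a + (X 0 + eT' 0 + klC1AnFit' cc cc' 0) ≤ x₀ / 2) :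
    TwoLegReadJetBound L M cc cc' β U μ (klFlowFrameU L M β U μ (m + 1)) (m + 1) ∧
      TwoLegReadOscAt L M x₀ β U μ (klFlowFrameU L M β U μ (m + 1)) (m + 1) := by
  have hR : ∀ j, 0 ≤ R.Gfr j := hRW.2.2
  have hcle : c ≤ klCurveC3 R := hc6.trans ((klEngC₃6_le_klEngC₃3 P R).trans (klEngC₃3_le_klCurveC3 P hR))
  have hUle : U ≤ klCurveU0 R := hU9.trans ((klEngU₀9_le_klEngU₀3 P R c).trans (klEngU₀3_le_klCurveU0 P hR c))
  have hU1 : U ≤ 1 := hUle.trans (klCurveU0_le_one R)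
  have hreg : IsKLRegime U c (-((m + 1 : ℕ) : ℤ)) := isKLRegime_of_le_nScales_succ hc.le hβmin hβc (by omega)
  obtain ⟨hJdiff, hJ⟩ := readResidueC1_hJ_analytic_klEng (L := L) (M := M) hcertA hRW hc hc6 hμ hU hU9 hβmin hβc hm5 hreg
    (FrameOK.mono hR (hNn.trans (by omega)) hOK₂) (fun m' hm' => hP m' (by omega)) hcc hcc' hIH
  have hG34U : 2 * (R.Gfr 3 + R.Gfr 4) * U ^ 2 ≤ 1 := by
    have hU4 : U ≤ klEngU₀4 P R c := hU9.trans (klEngU₀9_le_klEngU₀4 P R c)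
    have h3 := gfr_mul_le_of_le_klEngU₀4 (P := P) hRW hU4 (show 3 < 5 by norm_num)
    have h4 := gfr_mul_le_of_le_klEngU₀4 (P := P) hRW hU4 (show 4 < 5 by norm_num)
    have hG3 := hR 3
    have hG4 := hR 4
    have hs : R.Gfr 3 * U + R.Gfr 4 * U ≤ 1 / 2 ^ 127 + 1 / 2 ^ 127 := add_le_add h3 h4
    have e : 2 * (R.Gfr 3 + R.Gfr 4) * U ^ 2 = 2 * U * (R.Gfr 3 * U + R.Gfr 4 * U) := by ring
    rw [e]
    calc 2 * U * (R.Gfr 3 * U + R.Gfr 4 * U) ≤ 2 * 1 * (1 / 2 ^ 127 + 1 / 2 ^ 127) := by gcongr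
      _ ≤ 1 := by norm_num
  exact twoLegReadPriv_flow_succ_of_pos_pure_c2_l2 hR hc hcle hU hU1 hUle hG34U hβmin hβc hμ m hm1 hGS hQS hOK₁ hN₁ hOK₂ hNn hZ₂ hZ hP hTJ hmn hR0 hW hΞ hΘ
    hdoor hL hs hcN hcS hcE hcSs hcEs hNp0 hNp hSp hSps hSEp hSEs hX0 hXv hX hLdeg hA hAval hZsp hmT hmT1 hmT2 hmT3 hmT4 hmT5 heT hJdiff hJ
    (klC1AnFit_zero cc) hfit hfit' hfitO

/-- **«(P)-STEP-TABLE» — the private (P)-step at a SHALLOW general scale `m + 1 ≤ 21`, `m + 1 ≤ n_β`, with (B), (C2) AND (C1) discharged by name, (C2) on the U-AWARE (L2) table** (`2(Gfr₃+Gfr₄)U² ≤ 1` discharged from `Gfr_j·U ≤ 2⁻¹²⁷`)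
((C1) = k3c3-p1's table branch `readResidueC1_hJ_of_twoLegReadJetBound_klEng` at a cutoff-defect certificate `CutoffDefectCertFrame (klFlowDeg m) A T`,
read below ANY tables `eJ, eJ′` dominating its explicit linear forms at `k ≤ 4`, `eJ 0 = 0`).  See the module docstring.
[cite: BenfattoGiulianiMastropietro2006, §2.4 Lemma 2.1 (2.36)–(2.42)] -/
theorem twoLegReadPriv_flow_succ_table_l2 {P : SplitConsts} {R : RenConsts} (hRW : R.WF) {c : ℝ} (hc : 0 < c) (hc6 : c ≤ klEngC₃6 P R)
    {U : ℝ} (hU : 0 < U) (hU9 : U ≤ klEngU₀9 P R c) {β : ℝ} (hβmin : klBetaMin ≤ β) (hβc : β ≤ Real.exp (c / U ^ 2))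
    {μ : ℝ} (hμ : μ ∈ klWindowC) (m : ℕ) (hm21 : m + 1 ≤ 21) (hm1 : m + 1 ≤ nScales β)
    {G : GeoConsts} {Q : EngConsts} (hGS : ∀ k, 0 ≤ G.S k) (hQS : ∀ k, 0 ≤ Q.S' k)
    {Nf₁ N : ℕ} (hOK₁ : FrameOK R U Nf₁ μ (klFlowFrameU L M β U μ m)) (hN₁ : Nf₁ ≤ m) (hOK₂ : FrameOK R U N μ (klFlowFrameU L M β U μ (m + 1))) (hNn : N ≤ m)
    (hZ₂ : IsUnit (effPartitionFn ℂ (normalCovariance L M (uvSymbolCT L M β μ (klFlowFrameU L M β U μ (m + 1)) (klScale klE0 m))) (hubbardInteraction L M β U + counterQuadratic L M β (klFlowFrameU L M β U μ (m + 1)))))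
    (hZ : ∀ t ∈ Set.Icc (0 : ℝ) 1, effPartitionFn ℂ
      (normalCovariance L M (uvSymbolCT L M β μ (klFlowFrameU L M β U μ m) (klScale klE0 m)) + ((t : ℂ)) • (normalCovariance L M (fun ks => uvSymbolCT L M β μ (klFlowFrameU L M β U μ (m + 1)) (klScale klE0 m) ks / (1 + uvSymbolCT L M β μ (klFlowFrameU L M β U μ (m + 1)) (klScale klE0 m) ks * (((fsub (klFlowFrameU L M β U μ (m + 1)) (klFlowFrameU L M β U μ m)).eval (latticeMomentum L ks.1.2) / (β * (L : ℝ) ^ 2) : ℝ) : ℂ))) - normalCovariance L M (uvSymbolCT L M β μ (klFlowFrameU L M β U μ m) (klScale klE0 m)))) (hubbardInteraction L M β U + counterQuadratic L M β (klFlowFrameU L M β U μ m)) ≠ 0)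
    -- the flow history and the closed envelopes (verbatim from the door)
    {n : ℕ} (hP : ∀ m' ≤ n, FlowPieceJetsAt L M β U μ R m') (hTJ : ∀ m' ≤ n, TwoLegReadJetsF L M G Q β U μ m') (hmn : m ≤ n)
    (hR0 : 0 < R.Gfr 0) {W Ξ Θ : ℝ} (hW : W = curveExtC (8 * 576 * (342 : ℝ) ^ 4) G.S 1 + curveExtC (8 * 576 * (342 : ℝ) ^ 4) Q.S' 1 * |U|)
    (hΞ : Ξ = (2 ^ 10 * (1 + Real.pi ^ 8 * (W * U ^ 2) / 2 ^ 11) + ∑ j ∈ range 5, R.Gfr j))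
    (hΘ : Θ = (1 + ((∑ j ∈ range 5, R.Gfr j) + Real.pi ^ 8 * W / 2 ^ 11) * |U| / R.Gfr 0))
    (hdoor : R.Gfr 0 * |U| + ((∑ j ∈ range 5, R.Gfr j) + Real.pi ^ 8 * W / 2 ^ 11) * U ^ 2 ≤ 1 / 128) (hL : klEngL₄ P R β U ≤ L)
    {s : ℕ} (hs : 30 ≤ s)
    -- E1: β-free graded constant families (four-leg: PURE weight, `U²` law at orders ≥ 1)
    {cN cS cE : ℕ → ℝ} {cSs cEs : ℝ} (hcN : ∀ l, 0 ≤ cN l) (hcS : ∀ l, 0 ≤ cS l) (hcE : ∀ l, 0 ≤ cE l) (hcSs : 0 ≤ cSs) (hcEs : 0 ≤ cEs)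
    (hNp0 : ∀ t ∈ Set.Icc (0 : ℝ) 1, ∀ (σ : Fin 2) (A : HubbardFieldIdx L M) (x₀ : SpaceTimeIdx L M), imagTimeWeight β M ^ 3 *
      ∑ x ∈ (univ : Finset (Fin 4 → SpaceTimeIdx L M)).filter (fun x => x 0 = x₀),
        (((((x 1).2 - (x 0).2) 0).valMinAbs.natAbs : ℝ) + ((((x 1).2 - (x 0).2) 1).valMinAbs.natAbs : ℝ)) ^ 0 *
          ‖sectorisedKernel L M β (trivialMultiplier L M)
            (effAction ℂ (normalCovariance L M (uvSymbolCT L M β μ (klFlowFrameU L M β U μ m) (klScale klE0 m)) + ((t : ℂ)) • (normalCovariance L M (fun ks => uvSymbolCT L M β μ (klFlowFrameU L M β U μ (m + 1)) (klScale klE0 m) ks / (1 + uvSymbolCT L M β μ (klFlowFrameU L M β U μ (m + 1)) (klScale klE0 m) ks * (((fsub (klFlowFrameU L M β U μ (m + 1)) (klFlowFrameU L M β U μ m)).eval (latticeMomentum L ks.1.2) / (β * (L : ℝ) ^ 2) : ℝ) : ℂ))) - normalCovariance L M (uvSymbolCT L M β μ (klFlowFrameU L M β U μ m) (klScale klE0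 m)))) (hubbardInteraction L M β U + counterQuadratic L M β (klFlowFrameU L M β U μ m))) 4
            (![((0, σ), 0), ((0, σ), 1), ((0, A.1.2), 1 - A.2), ((0, A.1.2), A.2)] : Fin 4 → SectorLeg 1) x‖ ≤ cN 0 * U)
    (hNp : ∀ l, 1 ≤ l → l ≤ 4 → ∀ t ∈ Set.Icc (0 : ℝ) 1, ∀ (σ : Fin 2) (A : HubbardFieldIdx L M) (x₀ : SpaceTimeIdx L M), imagTimeWeight β M ^ 3 *
      ∑ x ∈ (univ : Finset (Fin 4 → SpaceTimeIdx L M)).filter (fun x => x 0 = x₀),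
        (((((x 1).2 - (x 0).2) 0).valMinAbs.natAbs : ℝ) + ((((x 1).2 - (x 0).2) 1).valMinAbs.natAbs : ℝ)) ^ l *
          ‖sectorisedKernel L M β (trivialMultiplier L M)
            (effAction ℂ (normalCovariance L M (uvSymbolCT L M β μ (klFlowFrameU L M β U μ m) (klScale klE0 m)) + ((t : ℂ)) • (normalCovariance L M (fun ks => uvSymbolCT L M β μ (klFlowFrameU L M β U μ (m + 1)) (klScale klE0 m) ks / (1 + uvSymbolCT L M β μ (klFlowFrameU L M β U μ (m + 1)) (klScale klE0 m) ks * (((fsub (klFlowFrameU L M β U μ (m + 1)) (klFlowFrameU L M β U μ m)).eval (latticeMomentum L ks.1.2) / (β * (L : ℝ) ^ 2) : ℝ) : ℂ))) - normalCovariance L M (uvSymbolCT L M β μ (klFlowFrameU L M β U μ m) (klScale klE0 m)))) (hubbardInteraction L M β U + counterQuadratic L M β (klFlowFrameU L M β U μ m))) 4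
            (![((0, σ), 0), ((0, σ), 1), ((0, A.1.2), 1 - A.2), ((0, A.1.2), A.2)] : Fin 4 → SectorLeg 1) x‖ ≤ cN l * U ^ 2 * ((4 : ℝ) ^ m) ^ l)
    (hSp : ∀ l ≤ 4, ∀ t ∈ Set.Icc (0 : ℝ) 1, ∀ (σ : Fin 2) (x₀ : SpaceTimeIdx L M),
      (imagTimeWeight β M * ∑ x ∈ (univ : Finset (Fin 2 → SpaceTimeIdx L M)).filter (fun x => x 0 = x₀),
        (1 + ((((x 1).2 - (x 0).2) 0).valMinAbs.natAbs : ℝ) + ((((x 1).2 - (x 0).2) 1).valMinAbs.natAbs : ℝ)) ^ l *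
          ‖sectorisedKernel L M β (trivialMultiplier L M)
            (effAction ℂ (normalCovariance L M (uvSymbolCT L M β μ (klFlowFrameU L M β U μ m) (klScale klE0 m)) + ((t : ℂ)) • (normalCovariance L M (fun ks => uvSymbolCT L M β μ (klFlowFrameU L M β U μ (m + 1)) (klScale klE0 m) ks / (1 + uvSymbolCT L M β μ (klFlowFrameU L M β U μ (m + 1)) (klScale klE0 m) ks * (((fsub (klFlowFrameU L M β U μ (m + 1)) (klFlowFrameU L M β U μ m)).eval (latticeMomentum L ks.1.2) / (β * (L : ℝ) ^ 2) : ℝ) : ℂ))) - normalCovariance L M (uvSymbolCT L M β μ (klFlowFrameU L M β U μ m) (klScale klE0 m)))) (hubbardInteraction L M β U + counterQuadratic L M β (klFlowFrameU L M β U μ m))) 2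
            (![((0, σ), 0), ((0, σ), 1)] : Fin 2 → SectorLeg 1) x‖ ≤ cS l * U * ((4 : ℝ) ^ m) ^ l))
    (hSps : ∀ t ∈ Set.Icc (0 : ℝ) 1, ∀ (σ : Fin 2) (x₀ : SpaceTimeIdx L M),
      (imagTimeWeight β M * ∑ x ∈ (univ : Finset (Fin 2 → SpaceTimeIdx L M)).filter (fun x => x 0 = x₀),
        (1 + ((((x 1).2 - (x 0).2) 0).valMinAbs.natAbs : ℝ) + ((((x 1).2 - (x 0).2) 1).valMinAbs.natAbs : ℝ)) ^ s *
          ‖sectorisedKernel L M β (trivialMultiplier L M)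
            (effAction ℂ (normalCovariance L M (uvSymbolCT L M β μ (klFlowFrameU L M β U μ m) (klScale klE0 m)) + ((t : ℂ)) • (normalCovariance L M (fun ks => uvSymbolCT L M β μ (klFlowFrameU L M β U μ (m + 1)) (klScale klE0 m) ks / (1 + uvSymbolCT L M β μ (klFlowFrameU L M β U μ (m + 1)) (klScale klE0 m) ks * (((fsub (klFlowFrameU L M β U μ (m + 1)) (klFlowFrameU L M β U μ m)).eval (latticeMomentum L ks.1.2) / (β * (L : ℝ) ^ 2) : ℝ) : ℂ))) - normalCovariance L M (uvSymbolCT L M β μ (klFlowFrameU L M β U μ m) (klScale klE0 m)))) (hubbardInteraction L M β U + counterQuadratic L M β (klFlowFrameU L M β U μ m))) 2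
            (![((0, σ), 0), ((0, σ), 1)] : Fin 2 → SectorLeg 1) x‖ ≤ cSs * U * ((4 : ℝ) ^ m) ^ s))
    (hSEp : ∀ l ≤ 4, ∀ (σ : Fin 2) (x₀ : SpaceTimeIdx L M),
      (imagTimeWeight β M * ∑ x ∈ (univ : Finset (Fin 2 → SpaceTimeIdx L M)).filter (fun x => x 0 = x₀),
        (1 + ((((x 1).2 - (x 0).2) 0).valMinAbs.natAbs : ℝ) + ((((x 1).2 - (x 0).2) 1).valMinAbs.natAbs : ℝ)) ^ l *
          ‖sectorisedKernel L M β (trivialMultiplier L M)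
            (effAction ℂ (normalCovariance L M (fun ks => uvSymbolCT L M β μ (klFlowFrameU L M β U μ (m + 1)) (klScale klE0 m) ks / (1 + uvSymbolCT L M β μ (klFlowFrameU L M β U μ (m + 1)) (klScale klE0 m) ks * (((fsub (klFlowFrameU L M β U μ (m + 1)) (klFlowFrameU L M β U μ m)).eval (latticeMomentum L ks.1.2) / (β * (L : ℝ) ^ 2) : ℝ) : ℂ)))) (hubbardInteraction L M β U + counterQuadratic L M β (klFlowFrameU L M β U μ m))) 2
            (![((0, σ), 0), ((0, σ), 1)] : Fin 2 → SectorLeg 1) x‖ ≤ cE l * U * ((4 : ℝ) ^ m) ^ l))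
    (hSEs : ∀ (σ : Fin 2) (x₀ : SpaceTimeIdx L M),
      (imagTimeWeight β M * ∑ x ∈ (univ : Finset (Fin 2 → SpaceTimeIdx L M)).filter (fun x => x 0 = x₀),
        (1 + ((((x 1).2 - (x 0).2) 0).valMinAbs.natAbs : ℝ) + ((((x 1).2 - (x 0).2) 1).valMinAbs.natAbs : ℝ)) ^ s *
          ‖sectorisedKernel L M β (trivialMultiplier L M)
            (effAction ℂ (normalCovariance L M (fun ks => uvSymbolCT L M β μ (klFlowFrameU L M β U μ (m + 1)) (klScale klE0 m) ks / (1 + uvSymbolCT L M β μ (klFlowFrameU L M β U μ (m + 1)) (klScale klE0 m) ks * (((fsub (klFlowFrameU L M β U μ (m + 1)) (klFlowFrameU L M β U μ m)).eval (latticeMomentum L ks.1.2) / (β * (L : ℝ) ^ 2) : ℝ) : ℂ)))) (hubbardInteraction L M β U + counterQuadratic L M β (klFlowFrameU L M β U μ m))) 2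
            (![((0, σ), 0), ((0, σ), 1)] : Fin 2 → SectorLeg 1) x‖ ≤ cEs * U * ((4 : ℝ) ^ m) ^ s))
    -- the (B) budget word as a primed table
    {X : ℕ → ℝ} (hX0 : ∀ l, 0 ≤ X l)
    (hXv : 2 ^ 32 / 4 ^ 0 * R.Gfr 0 * cN 0 + (klEngRsq R ^ 4 * (cS 0 ^ 2 + cE 0 + 1) + (cSs ^ 2 + cEs + 1)) / 2 ^ 200 ≤ X 0)
    (hX : ∀ l, 1 ≤ l → l ≤ 4 → 2 ^ 32 / 4 ^ l * R.Gfr 0 * cN l + (klEngRsq R ^ 4 * (cS l ^ 2 + cE l + 1) + (cSs ^ 2 + cEs + 1)) / 2 ^ 200 ≤ X l)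
    -- the (P)-step's other inputs (k3c3-p1 `twoLegReadPriv_flow_succ` at `n := m`)
    (hLdeg : 4 * klFlowDeg (m + 1) ≤ L)
    {cA cA' cc cc' : ℕ → ℝ} {τA a x₀ : ℝ} (hcc : ∀ k, 0 ≤ cc k) (hcc' : ∀ k, 0 ≤ cc' k)
    -- (A): slice-increment jets and structured value at the new frame
    (hA : TwoLegCurveJetBound L M cA cA' β U μ (klFlowFrameU L M β U μ (m + 1)) (m + 1))
    (hAval : ∀ θ : ℝ, |klTwoLegCurveProfile L M β U μ (klFlowFrameU L M β U μ (m + 1)) (m + 1) θ - τA| ≤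
      a * U ^ 2 * (4 : ℝ) ^ (-2 * ((m + 1 : ℕ) : ℤ)))
    -- (C2): the #17 export at `(K_m, m)`, five n-free rows, and a primed table above `transport_jets_flow_fit`'s
    {z : ℕ → ℝ} (hZsp : TwoLegDualSpaceMomentsUpToAt L M (klZspLaw z U m) β U μ m 5)
    {mT : ℕ → ℝ} (hmT : ∀ j, 0 ≤ mT j)
    (hmT1 : 4 / 3 * R.Gfr 1 + 2 * z 1 ≤ mT 1) (hmT2 : R.Gfr 2 + 2 * z 2 ≤ mT 2) (hmT3 : R.Gfr 3 / 3 + 2 * z 3 ≤ mT 3)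
    (hmT4 : R.Gfr 4 / 15 + 2 * z 4 ≤ mT 4) (hmT5 : 2 ^ 5 * (Real.pi ^ 8 / 4 * 2 ^ 4 * (2 : ℝ) ^ 32) * (curveExtC (klChi2CauchyTab2 4) G.S 1 + curveExtC (klChi2CauchyTab2 4) Q.S' 1 * |U|) / 63 + 2 * z 5 ≤ mT 5)
    {eT' : ℕ → ℝ} (heT : ∀ k ≤ 4,
        (fun k : ℕ =>
          if k = 0 then 16 * ((12.2 * R.Gfr 0 * mT 1))
          else if k = 1 then 4 * ((1420 * 2 * (R.Gfr 1 + R.Gfr 2 + R.Gfr 3 + R.Gfr 4) * 2 * mT 1) + (36400 * R.Gfr 0 * mT 1) + (2820 * R.Gfr 0 * mT 2))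
          else if k = 2 then ((12900000 * 2 ^ 2 * (R.Gfr 1 + R.Gfr 2 + R.Gfr 3 + R.Gfr 4) * 2 ^ 2 * mT 1) + (657000 * 2 * (R.Gfr 1 + R.Gfr 2 + R.Gfr 3 + R.Gfr 4) * 2 * mT 2) + (338000000 * 2 * R.Gfr 0 * 2 * mT 1) + (25400000 * R.Gfr 0 * mT 2) + (652000 * R.Gfr 0 * mT 3))
          else if k = 3 then ((199000000000 * 2 ^ 3 * (R.Gfr 1 + R.Gfr 2 + R.Gfr 3 + R.Gfr 4) * 2 ^ 3 * mT 1) + (12000000000 * 2 ^ 2 * (R.Gfr 1 + R.Gfr 2 + R.Gfr 3 + R.Gfr 4) * 2 ^ 2 * mT 2) + (228000000 * 2 * (R.Gfr 1 + R.Gfr 2 + R.Gfr 3 + R.Gfr 4) * 2 * mT 3) + (5230000000000 * 2 ^ 2 * R.Gfr 0 * 2 ^ 2 * mT 1) + (392000000000 * 2 * R.Gfr 0 * 2 * mT 2) + (11800000000 * R.Gfr 0 * mT 3) + (151000000 * R.Gfr 0 * mT 4)) / 4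
          else if k = 4 then ((4300000000000000 * 2 ^ 4 * (R.Gfr 1 + R.Gfr 2 + R.Gfr 3 + R.Gfr 4) * 2 ^ 4 * mT 1) + (276000000000000 * 2 ^ 3 * (R.Gfr 1 + R.Gfr 2 + R.Gfr 3 + R.Gfr 4) * 2 ^ 3 * mT 2) + (6890000000000 * 2 ^ 2 * (R.Gfr 1 + R.Gfr 2 + R.Gfr 3 + R.Gfr 4) * 2 ^ 2 * mT 3) + (70100000000 * 2 * (R.Gfr 1 + R.Gfr 2 + R.Gfr 3 + R.Gfr 4) * 2 * mT 4) + (114000000000000000 * 2 ^ 2 * R.Gfr 0 * 2 ^ 2 * mT 1) + (8490000000000000 * 2 ^ 2 * R.Gfr 0 * 2 ^ 2 * mT 2) + (272000000000000 * 2 * R.Gfr 0 * 2 * mT 3) + (4530000000000 * R.Gfr 0 * mT 4) + (34800000000 * R.Gfr 0 * mT 5) + (69200000000 * (16 / 15) * R.Gfr 4 * mT 1)) / 16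
          else 0) k ≤ eT' k)
    -- (C1): the cutoff-defect certificate of the table branch at degree `klFlowDeg m`, the induction hypothesis (jets half), tables above the door's
    {d : ℕ} (hd : klFlowDeg m = d) {A : ℕ → ℝ} {T : CutoffDefectTable} (hcert : CutoffDefectCertFrame d A T) (hTd : 0 ≤ T.Td) (hN0 : 0 ≤ T.N0)
    (hA12 : ∀ j ≤ 4, (1 : ℝ) / 10 ^ 12 ≤ A j) (hIH : TwoLegReadJetBound L M cc cc' β U μ (klFlowFrameU L M β U μ m) m)
    {eJ eJ' : ℕ → ℝ} (heJ0 : eJ 0 = 0)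
    (heJ : ∀ k ≤ 4,
        (fun k => if k = 0 then 0 else
          (if k ≤ 3 then T.bound (fun l : ℕ => if l = 0 then π / 2 * cc 1 * (4 : ℝ) ^ ((((1 : ℕ) : ℤ) - 2) * m) else cc l * (4 : ℝ) ^ (((l : ℤ) - 2) * m)) k
            else T.boundNR (fun l : ℕ => if l = 0 then π / 2 * cc 1 * (4 : ℝ) ^ ((((1 : ℕ) : ℤ) - 2) * m) else cc l * (4 : ℝ) ^ (((l : ℤ) - 2) * m)) k) *
            ((4 : ℝ) ^ (((k : ℤ) - 2) * ((m + 1 : ℕ) : ℤ)))⁻¹) k ≤ eJ k)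
    (heJ' : ∀ k ≤ 4,
        (fun k => if k = 0 then (cc 1 + cc' 1) * (T.Td + π / 2 * T.N0) * (4 : ℝ) ^ ((((1 : ℕ) : ℤ) - 2) * m) *
            ((4 : ℝ) ^ ((((0 : ℕ) : ℤ) - 2) * ((m + 1 : ℕ) : ℤ)))⁻¹ else
          (if k ≤ 3 then T.bound (fun l : ℕ => if l = 0 then π / 2 * cc' 1 * (4 : ℝ) ^ ((((1 : ℕ) : ℤ) - 2) * m) else cc' l * (4 : ℝ) ^ (((l : ℤ) - 2) * m)) k
            else T.boundNR (fun l : ℕ => if l = 0 then π / 2 * cc' 1 * (4 : ℝ) ^ ((((1 : ℕ) : ℤ) - 2) * m) else cc' l * (4 : ℝ) ^ (((l : ℤ) - 2) * m)) k) *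
            ((4 : ℝ) ^ (((k : ℤ) - 2) * ((m + 1 : ℕ) : ℤ)))⁻¹) k ≤ eJ' k)
    -- the three private fits, (B) and (C2) un-primed columns EMPTY
    (hfit : ∀ k, cA k + eJ k ≤ cc k)
    (hfit' : ∀ k, cA' k + ((if k = 0 then X 0 else readJetC X k + readJetC' R X k) + eT' k + eJ' k) ≤ cc' k)
    (hfitO : a + (X 0 + eT' 0 + eJ' 0) ≤ x₀ / 2) :
    TwoLegReadJetBound L M cc cc' β U μ (klFlowFrameU L M β U μ (m + 1)) (m + 1) ∧
      TwoLegReadOscAt L M x₀ β U μ (klFlowFrameU L M β U μ (m + 1)) (m + 1) := by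
  have hR : ∀ j, 0 ≤ R.Gfr j := hRW.2.2
  have hcle : c ≤ klCurveC3 R := hc6.trans ((klEngC₃6_le_klEngC₃3 P R).trans (klEngC₃3_le_klCurveC3 P hR))
  have hUle : U ≤ klCurveU0 R := hU9.trans ((klEngU₀9_le_klEngU₀3 P R c).trans (klEngU₀3_le_klCurveU0 P hR c))
  have hU1 : U ≤ 1 := hUle.trans (klCurveU0_le_one R)
  obtain ⟨hJdiff, hJ0⟩ := readResidueC1_hJ_of_twoLegReadJetBound_klEng (L := L) (M := M) hRW hc hc6 hμ hU hU9 hβmin hβc hm21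
    (FrameOK.mono hR (hNn.trans (by omega)) hOK₂) (fun m' hm' => hP m' (by omega)) hd hcert hTd hN0 hA12 hcc hcc' hIH
  have hJ : ∀ k ≤ 4, ∀ θ : ℝ, |iteratedDeriv k (fun θ : ℝ => klLocalPart L M β U μ (klFlowFrameU L M β U μ m) m θ -
      (klFlowPiece L M β U μ m).eval (klFermiPoint μ (klFlowFrameU L M β U μ (m + 1)) θ)) θ| ≤ curveJetBar eJ eJ' U k (m + 1) :=
    fun k hk θ => (hJ0 k hk θ).trans (curveJetBar_mono_at (heJ k hk) (heJ' k hk))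
  have hG34U : 2 * (R.Gfr 3 + R.Gfr 4) * U ^ 2 ≤ 1 := by
    have hU4 : U ≤ klEngU₀4 P R c := hU9.trans (klEngU₀9_le_klEngU₀4 P R c)
    have h3 := gfr_mul_le_of_le_klEngU₀4 (P := P) hRW hU4 (show 3 < 5 by norm_num)
    have h4 := gfr_mul_le_of_le_klEngU₀4 (P := P) hRW hU4 (show 4 < 5 by norm_num)
    have hG3 := hR 3
    have hG4 := hR 4
    have hs : R.Gfr 3 * U + R.Gfr 4 * U ≤ 1 / 2 ^ 127 + 1 / 2 ^ 127 := add_le_add h3 h4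
    have e : 2 * (R.Gfr 3 + R.Gfr 4) * U ^ 2 = 2 * U * (R.Gfr 3 * U + R.Gfr 4 * U) := by ring
    rw [e]
    calc 2 * U * (R.Gfr 3 * U + R.Gfr 4 * U) ≤ 2 * 1 * (1 / 2 ^ 127 + 1 / 2 ^ 127) := by gcongr
      _ ≤ 1 := by norm_num
  exact twoLegReadPriv_flow_succ_of_pos_pure_c2_l2 hR hc hcle hU hU1 hUle hG34U hβmin hβc hμ m hm1 hGS hQS hOK₁ hN₁ hOK₂ hNn hZ₂ hZ hP hTJ hmn hR0 hW hΞ hΘ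
    hdoor hL hs hcN hcS hcE hcSs hcEs hNp0 hNp hSp hSps hSEp hSEs hX0 hXv hX hLdeg hA hAval hZsp hmT hmT1 hmT2 hmT3 hmT4 hmT5 heT hJdiff hJ
    heJ0 hfit hfit' hfitO

end Summit.HubbardSuperconductivity.HubbardSuperconductivity.Theorems.EngineV8

end
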